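import Summits.ABC.IUTFork.Cor312ProvKRamified
import Summits.ABC.IUTFork.Cor312LicenceExplicitDepth
import Literature.IUT.LogVolume.LogRadiusBounds
import HarnessLib

/-!
# [IUTchIII] Cor. 3.12 over `K` — at the `K`-level genuine datum the LABEL-THRESHOLD refutation leg is VOID:
# every label index is `< l ≤ e(x₀|p)`, so `e·(d + a + b + 3) ≤ i₀` is unsatisfiable at every bad place

PROOF-ONLY companion (no `def`, no new `Prop`) of `Cor312ProvKRamified.lean` (abc-iut-w5-d054 p436520 / abc-iut-C-cert-2 p437367: every bad
place of the `K`-level pilot datum `Cor312Prov.pilotDataOfK D K` is ramified with `l ≤ e(w|p)`) by the branch-C certificate seat abc-iut-C-cert-2,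
sharpening the §K (4) «depth dichotomy» sentence AT THE DATUM OF THE LINE OF RECORD `Conditional.abc_of_SH_v6K` (same service as C-R19 Q1 for
«case A»). abc-iut-w4-d092's TOP-LABEL / LARGE-`l` refutation `Thm311.Real.not_exists_qPinned_hull_settingPrVolSharp_of_label_ge` (p439248,
generic pilot data `X`) fires at a bad place `x₀ | p` and a label `i₀ + 1 ≤ l⋆` under `hlabel : e·(d + a + b + 3) ≤ i₀` (`e = e(K_{x₀}/ℚ_p)`, `d, a, b`
the [IUTchIV] Prop. 1.1/1.2 constants of `K_{x₀}`). AT `X := pilotDataOfK D K` THIS NEVER HAPPENS: `i₀ < l⋆ < l ≤ e ≤ e·(d + a + b + 3)`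
(`d ≥ 0`, `a ≥ 1/e > 0`, `b ≥ −1/e ≥ −1` so `d + a + b + 3 ≥ 1`) — `not_labelThreshold_at_pilotDataOfK`. So at the print-faithful `K`-level datum, of
the refutation legs in the tree — case A (p433074: VOID by `not_caseA_at_pilotDataOfK`), label threshold (p439248: VOID, this file), and q-DEPTH
(`Conditional.GenuineK.not_pilotKummerCompatHull_chosen_of_explicit_depth` / `not_hSH_v6K_of_exists_deep`, p438886) — ONLY THE q-DEPTH LEG IS LIVE:
whether v6K's `hSH` fails at a given admissible datum is decided (as far as the tree's refutations go) by the q-order at a bad place alone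
(`(j²−1)·ord_{x₀}(q)/(2l·e) > (j+1)(d+a+b)+1`, in which `ord_{x₀}(q)/e = ord_v(q_v)/e(v|p)` does not see the ramification of `K/F`) — the «HEX»
question of abc-iut-C-cert-1's sizing. Statements about OUR typed objects; no side taken on [IUTchIII] Cor. 3.12 or any author; typed ≠ proved;
instantiated ≠ endorsed. [cite: Mochizuki2012, IUTchI Def. 3.1 (c),(e) pp. 61–62; IUTchIV Prop. 1.2 p. 10] [cite: NeukirchANT1999, Ch. II Prop. (6.8)]
-/

noncomputable section

open Set Function NumberField IsDedekindDomain

namespace Summit.ABC.IUTFork.Cor312Prov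

open Literature.IUT.LogVolume Literature.IUT.HodgeTheaters Thm311 Thm311.Real

/-! ## §1. Elementary signs of the [IUTchIV] Prop. 1.2 constants -/

/-- **`b ≥ −1`**: `b = ⌊log(p·e/(p−1))/log p⌋ − 1/e` with `p·e/(p−1) ≥ 1` (so the floor is `≥ 0`) and `1/e ≤ 1`.
[cite: Mochizuki2012, IUTchIV Prop. 1.2 p. 10] -/
theorem neg_one_le_logRadiusB {p e : ℕ} (hp : 2 ≤ p) (he : 1 ≤ e) : -1 ≤ logRadiusB p e := by
  unfold logRadiusB
  have hpR : (2 : ℝ) ≤ p := by exact_mod_cast hp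
  have heR : (1 : ℝ) ≤ e := by exact_mod_cast he
  have hp1 : (0 : ℝ) < (p : ℝ) - 1 := by linarith
  have hlogp : 0 < Real.log p := Real.log_pos (by linarith)
  have hq : (1 : ℝ) ≤ (p : ℝ) * e / ((p : ℝ) - 1) := by
    rw [le_div_iff₀ hp1]
    nlinarith
  have hfloor : (0 : ℝ) ≤ (⌊Real.log ((p : ℝ) * e / ((p : ℝ) - 1)) / Real.log p⌋ : ℝ) := by
    have h0 : (0 : ℤ) ≤ ⌊Real.log ((p : ℝ) * e / ((p : ℝ) - 1)) / Real.log p⌋ :=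
      Int.floor_nonneg.mpr (div_nonneg (Real.log_nonneg hq) hlogp.le)
    exact_mod_cast h0
  have hinv : 1 / (e : ℝ) ≤ 1 := by
    rw [div_le_one (by linarith)]
    exact heR
  linarith

/-- **`1 ≤ d + a + b + 3`** for the constants of any finite extension `K₀/ℚ_p` (`d ≥ 0`, `a ≥ 1/e > 0`, `b ≥ −1`).
[cite: Mochizuki2012, IUTchIV Prop. 1.1 p. 9, Prop. 1.2 p. 10] -/
theorem one_le_depthConstants_add_three (p : ℕ) [hp : Fact p.Prime] (K₀ : Type) [NontriviallyNormedField K₀] [NormedAlgebra ℚ_[p] K₀]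
    [IsUltrametricDist K₀] [ProperSpace K₀] :
    1 ≤ differentOrd p K₀ + logRadiusA p (absRamificationIdx p K₀) + logRadiusB p (absRamificationIdx p K₀) + 3 := by
  have he : 1 ≤ absRamificationIdx p K₀ := absRamificationIdx_pos p K₀
  have hd : 0 ≤ differentOrd p K₀ := differentOrd_nonneg p K₀
  have ha : 0 ≤ logRadiusA p (absRamificationIdx p K₀) :=
    le_trans (by positivity) (one_div_le_logRadiusA hp.out he)
  have hb : -1 ≤ logRadiusB p (absRamificationIdx p K₀) := neg_one_le_logRadiusB hp.out.two_le he
  linarith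

/-! ## §2. At the `K`-level pilot datum: labels are below the ramification index of every bad completion -/

section OverK

variable {F K Fbar : Type} [Field F] [NumberField F] [Field K] [NumberField K] [Algebra F K] [Field Fbar]
  [Algebra F Fbar] [Algebra K Fbar] {E : WeierstrassCurve F} [E.IsElliptic] {l : ℕ} {Pb : BadPlacePredicates K}
  (D : InitialThetaData F K Fbar E l Pb)

/-- **`l ≤ e(K_{x₀}/ℚ_p)`** for the completion at a bad place of the `K`-level pilot datum, in the language of the real settings
(`absRamificationIdx p (kOf X p x₀)` = Mathlib's `e(x₀|ℤ)` by `absRamificationIdx_rescaledCompletion`; then abc-iut-w5-d054's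
`l_le_ramificationIdx_int_of_over_VFbad`). [cite: Mochizuki2012, IUTchI Def. 3.1 (c),(e) pp. 61–62] [cite: NeukirchANT1999, Ch. II Prop. (6.8)] -/
theorem l_le_absRamificationIdx_kOf_pilotDataOfK (pp : Nat.Primes) (x₀ : (thetaIndex (pilotDataOfK D K)).Fibre (.inr pp))
    (hx : haveI : Fact (pp : ℕ).Prime := ⟨pp.2⟩; placeOf (pilotDataOfK D K) pp.1 x₀ ∈ (pilotDataOfK D K).S) :
    haveI : Fact (pp : ℕ).Prime := ⟨pp.2⟩
    l ≤ absRamificationIdx (pp : ℕ) (kOf (pilotDataOfK D K) pp.1 x₀) := by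
  haveI : Fact (pp : ℕ).Prime := ⟨pp.2⟩
  have h := l_le_ramificationIdx_int_of_over_VFbad D (placeOf (pilotDataOfK D K) pp.1 x₀)
    ((mem_pilotDataOfK_S_iff D K _).mp hx)
  rwa [← absRamificationIdx_rescaledCompletion K (pp : ℕ) (placeOf (pilotDataOfK D K) pp.1 x₀)
    (natCast_mem_placeOf (pilotDataOfK D K) pp.1 x₀)] at h

/-- **Every label index `i₀ : Fin l⋆` is `< l ≤ e(K_{x₀}/ℚ_p)`** at a bad place of the `K`-level pilot datum (`l⋆ = (l−1)/2`).
[cite: Mochizuki2012, IUTchI Def. 3.1 (c),(e) pp. 61–62] -/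
theorem label_lt_absRamificationIdx_kOf_pilotDataOfK (pp : Nat.Primes) (x₀ : (thetaIndex (pilotDataOfK D K)).Fibre (.inr pp))
    (hx : haveI : Fact (pp : ℕ).Prime := ⟨pp.2⟩; placeOf (pilotDataOfK D K) pp.1 x₀ ∈ (pilotDataOfK D K).S)
    (i₀ : Fin (thetaIndex (pilotDataOfK D K)).lstar) :
    haveI : Fact (pp : ℕ).Prime := ⟨pp.2⟩
    (i₀ : ℕ) < absRamificationIdx (pp : ℕ) (kOf (pilotDataOfK D K) pp.1 x₀) := by
  haveI : Fact (pp : ℕ).Prime := ⟨pp.2⟩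
  have hi : (i₀ : ℕ) < (pilotDataOfK D K).lstar := i₀.2
  have hls : (pilotDataOfK D K).lstar = (l - 1) / 2 := by
    unfold PilotData.lstar
    rw [pilotDataOfK_l]
  have hle := l_le_absRamificationIdx_kOf_pilotDataOfK D pp x₀ hx
  omega

/-- **THE LABEL-THRESHOLD LEG IS VOID AT THE `K`-LEVEL DATUM.** The hypothesis `hlabel : e·(d + a + b + 3) ≤ i₀` of abc-iut-w4-d092's
`Thm311.Real.not_exists_qPinned_hull_settingPrVolSharp_of_label_ge` (p439248) is UNSATISFIABLE at `X := pilotDataOfK D K` at every bad place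
`x₀` and every label index `i₀ : Fin l⋆`: `i₀ < l ≤ e ≤ e·(d + a + b + 3)`. (So at the datum of the line of record `Conditional.abc_of_SH_v6K` the
only live refutation leg of its hypothesis `hSH` is the q-DEPTH one, `Conditional.not_hSH_v6K_of_exists_deep`.) No side taken.
[cite: Mochizuki2012, IUTchI Def. 3.1 (c),(e) pp. 61–62; IUTchIV Prop. 1.2 p. 10] -/
theorem not_labelThreshold_at_pilotDataOfK (pp : Nat.Primes) (x₀ : (thetaIndex (pilotDataOfK D K)).Fibre (.inr pp))
    (hx : haveI : Fact (pp : ℕ).Prime := ⟨pp.2⟩; placeOf (pilotDataOfK D K) pp.1 x₀ ∈ (pilotDataOfK D K).S)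
    (i₀ : Fin (thetaIndex (pilotDataOfK D K)).lstar) :
    haveI : Fact (pp : ℕ).Prime := ⟨pp.2⟩
    ¬ ((absRamificationIdx (pp : ℕ) (kOf (pilotDataOfK D K) pp.1 x₀) : ℝ) *
          (differentOrd (pp : ℕ) (kOf (pilotDataOfK D K) pp.1 x₀)
            + logRadiusA (pp : ℕ) (absRamificationIdx (pp : ℕ) (kOf (pilotDataOfK D K) pp.1 x₀))
            + logRadiusB (pp : ℕ) (absRamificationIdx (pp : ℕ) (kOf (pilotDataOfK D K) pp.1 x₀)) + 3) ≤ (i₀ : ℕ)) := by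
  haveI : Fact (pp : ℕ).Prime := ⟨pp.2⟩
  intro hlabel
  have hlt := label_lt_absRamificationIdx_kOf_pilotDataOfK D pp x₀ hx i₀
  have hone := one_le_depthConstants_add_three (pp : ℕ) (kOf (pilotDataOfK D K) pp.1 x₀)
  have he0 : (0 : ℝ) ≤ (absRamificationIdx (pp : ℕ) (kOf (pilotDataOfK D K) pp.1 x₀) : ℝ) := Nat.cast_nonneg _
  have hltR : ((i₀ : ℕ) : ℝ) < (absRamificationIdx (pp : ℕ) (kOf (pilotDataOfK D K) pp.1 x₀) : ℝ) := by exact_mod_cast hlt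
  -- `e ≤ e·(d+a+b+3)` and `i₀ < e`
  have hmul : (absRamificationIdx (pp : ℕ) (kOf (pilotDataOfK D K) pp.1 x₀) : ℝ) ≤
      (absRamificationIdx (pp : ℕ) (kOf (pilotDataOfK D K) pp.1 x₀) : ℝ) *
        (differentOrd (pp : ℕ) (kOf (pilotDataOfK D K) pp.1 x₀)
          + logRadiusA (pp : ℕ) (absRamificationIdx (pp : ℕ) (kOf (pilotDataOfK D K) pp.1 x₀))
          + logRadiusB (pp : ℕ) (absRamificationIdx (pp : ℕ) (kOf (pilotDataOfK D K) pp.1 x₀)) + 3) :=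
    le_mul_of_one_le_right he0 hone
  linarith

end OverK

end Summit.ABC.IUTFork.Cor312Prov

end
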